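import Literature.MathematicalPhysics.QuantumFieldTheory.BalabanImbrieJaffe1984to88.BIJ88Eq5128ScalarSector

/-!
# `BalabanImbrieJaffe1984to88.BIJ88HiggsRealForm` — T. Bałaban, J. Imbrie, A. Jaffe, *Effective action and cluster properties of the abelian Higgs
model*, Commun. Math. Phys. **114** (1988) 257–315 [BalabanImbrieJaffe1988], Sect. 5.12 pp. 300–302 [PDF 44–46] (*"The remaining integral is a
Gaussian integral in φ^{(k)} … exp[−½⟨φ^{(k)}, (Δ_k(u_{k+1}) + aL^{−2}P(u_{k+1}))φ^{(k)}⟩]"*, (5.12.2) p. 301): **THE `φ^{(k)}`-GAUSSIAN OF A COMPLEX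
KERNEL IN REAL COORDINATES.**  The scalar-sector files of this seat (`BIJ88Eq5128ScalarSector` p317381, `BIJ88Eq5128ScalarFunction` p320255/p320637)
take the `φ^{(k)}`-Gaussian in the form `exp[−½⟨φ_ℝ, M φ_ℝ⟩]`, `φ_ℝ = realCoords φ^{(k)} ∈ ℝ^{sites × {re, im}}`, `M` a real symmetric matrix with positive
definite `Λ₁₀`-block, measurable in the block field; the printed Gaussian is `exp[−½ Re⟨φ, Hφ⟩]` for the complex kernel `H = Δ_k(u_{k+1}) +
aL^{−2}P(u_{k+1})` on the sites (r18's reading of the scalar forms: `Re Σ_{x,y} \overline{φ(x)} H(x,y) φ(y)`, `BIJ88InductiveForm41.scalarForm`).  This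
file supplies the dictionary — the owner's *"M_t(v) ↔ printed operator"* half of the C2.Eq5.12.8 flip condition (r16 gen 12, 2026-08-22T06:10:48Z), at
the level of an ARBITRARY complex kernel: the real matrix `realMat H` (blocks `[[Re H, −Im H], [Im H, Re H]]`) with `Re⟨φ, Hφ⟩ = ⟨φ_ℝ, realMat H φ_ℝ⟩`
(`quadForm_realMat`), symmetric for Hermitian `H` (`realMat_isSymm`), positive definite — with its `Λ₁₀`-block — when the form is positive
(`realMat_posDef`, `blkIn_realMat_posDef`), measurable in parameters (`measurable_realMat`), and the Gaussian in the exact shape of the hypothesis `hJ`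
of the scalar-sector theorems (`higgsGaussian_realCoords`).  The identification of `H` with the tree's concrete `Δ_k(u_{k+1}) + aL^{−2}P(u_{k+1})` on the
torus is NOT made here (their carriers are p02's/r18's rows).

statement-level skeleton of published theorems with citation tags; proofs where landed; nothing here is a claim about the Yang–Mills mass gap

PDF held: `paper:balaban1988-cmp114-bij-abelian-higgs-effective-action` (journal page = PDF page + 256); pp. 300–301 [PDF 44–45] re-read this session.
CITATION HEADER (lean-in-tree rule).  Part of the lit-balaban TYPED SKELETON (HOME `run/shared/lean/pub/lit-balaban/`), PHASE-2 proof seat p34 gen 11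
(unit `lit-balaban-p34-g11`; own lineage).  Rows served (owner r16, ROWS-C2-part2): **C2.Eq5.12.8** / **C2.Eq5.12.1-5.12.7** (the real-coordinate
dictionary for the `φ^{(k)}`-Gaussian; members, no head change expected).

WHAT IS PROVED (kernel-checked; `realVec`, `realMat` are definitions with bodies; theorems otherwise; no `Prop`-valued fact; standard axioms; imports
`BIJ88Eq5128ScalarSector` only).  `realVec`, `realMat`, `realCoords_eq_realVec` (the tree's `realCoords` is `realVec`), `block_quadForm`,
**`quadForm_realMat`**, **`realMat_isSymm`**, `realVec_injective`, `realVec_surjective`, **`realMat_posDef`**, `blkIn_realMat_posDef`, `measurable_realMat`,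
**`higgsGaussian_realCoords`**.  NOT DONE: the concrete kernel of `Δ_k(u_{k+1}) + aL^{−2}P(u_{k+1})` on the torus carriers and its positivity (p. 300
*"bounded from above and below"* — a claim row); the gauge sector (HOME/GAPS.md G-C2-23).
-/

namespace Literature.MathematicalPhysics.QuantumFieldTheory.BalabanImbrieJaffe1984to88.BIJ88HiggsRealForm

open Literature.MathematicalPhysics.QuantumFieldTheory.Balaban1983to89
open BIJ85Sect1Model (HiggsField)
open BIJ88Eq5128ScalarSector (RIdx realCoords realCoords_apply)
open scoped BigOperators Matrix ComplexConjugate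
open _root_.MeasureTheory

noncomputable section

variable {S : Type} [Fintype S]

/-! ## §1 Real coordinates of a complex field and the real matrix of a complex kernel -/

/-- The real coordinates `(Re φ(x), Im φ(x))_{x}` of a complex field on a finite site set (`BIJ88Eq5128ScalarSector.realCoords` for
`φ^{(k)}`; here for any site type). [cite: BalabanImbrieJaffe1988, (5.12.2) p.301] -/
def realVec (φ : S → ℂ) : S × Fin 2 → ℝ := fun i => ![(φ i.1).re, (φ i.1).im] i.2

/-- **The real `2|S| × 2|S|` matrix of a complex kernel `H`**: the block `[[Re H(x,y), −Im H(x,y)], [Im H(x,y), Re H(x,y)]]` at `(x, y)` — the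
matrix `M` for which `Re⟨φ, Hφ⟩ = ⟨φ_ℝ, Mφ_ℝ⟩` (the form in which the `φ^{(k)}`-Gaussian `exp[−½⟨φ, (Δ_k(u_{k+1}) + aL^{−2}P(u_{k+1}))φ⟩]` of
Sect. 5.12 enters the real-coordinate conditioning of `BIJ88Eq5128ScalarSector`). [cite: BalabanImbrieJaffe1988, (5.12.2) p.301] -/
def realMat (H : Matrix S S ℂ) : Matrix (S × Fin 2) (S × Fin 2) ℝ :=
  fun i j => !![(H i.1 j.1).re, -(H i.1 j.1).im; (H i.1 j.1).im, (H i.1 j.1).re] i.2 j.2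

omit [Fintype S] in
/-- kernel: the tree's `realCoords` of `φ^{(k)}` is `realVec`. [cite: BalabanImbrieJaffe1988, (5.12.2) p.301] -/
theorem realCoords_eq_realVec {P : Params} {k : ℕ} (φ : HiggsField P k) : realCoords φ = realVec φ := by
  funext s
  rw [realCoords_apply]
  rfl

omit [Fintype S] in
/-- kernel: one `2 × 2` block of the quadratic form is the real part of one term of the sesquilinear form.
[cite: BalabanImbrieJaffe1988, (5.12.2) p.301] -/
theorem block_quadForm (H : Matrix S S ℂ) (φ : S → ℂ) (x y : S) :
    ∑ a : Fin 2, ∑ b : Fin 2, realVec φ (x, a) * (realMat H (x, a) (y, b) * realVec φ (y, b)) = (conj (φ x) * H x y * φ y).re := by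
  simp only [Fin.sum_univ_two, realVec, realMat, Matrix.cons_val_zero, Matrix.cons_val_one,
    Matrix.of_apply, Matrix.cons_val', Matrix.empty_val', Matrix.cons_val_fin_one, Complex.mul_re, Complex.mul_im, Complex.conj_re,
    Complex.conj_im]
  ring

/-- **`Re⟨φ, Hφ⟩ = ⟨φ_ℝ, M_H φ_ℝ⟩`**: the real part of the sesquilinear form of a complex kernel is the real quadratic form of its real matrix in
the real coordinates (any `H`; r18's reading of the scalar forms of (4.1)/(5.12.x) is `Re Σ_{x,y} \\overline{φ(x)} H(x,y) φ(y)`).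
[cite: BalabanImbrieJaffe1988, (5.12.2) p.301] -/
theorem quadForm_realMat (H : Matrix S S ℂ) (φ : S → ℂ) :
    realVec φ ⬝ᵥ (realMat H *ᵥ realVec φ) = (∑ x, ∑ y, conj (φ x) * H x y * φ y).re := by
  simp only [dotProduct, Matrix.mulVec, Finset.mul_sum, Complex.re_sum]
  rw [Fintype.sum_prod_type]
  refine Finset.sum_congr rfl fun x _ => ?_
  simp_rw [Fintype.sum_prod_type (f := fun j : S × Fin 2 => realVec φ (x, _) * (realMat H (x, _) j * realVec φ j))]
  rw [Finset.sum_comm]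
  refine Finset.sum_congr rfl fun y _ => ?_
  exact block_quadForm H φ x y

omit [Fintype S] in
/-- **A Hermitian kernel has a symmetric real matrix.** [cite: BalabanImbrieJaffe1988, (5.12.2) p.301] -/
theorem realMat_isSymm {H : Matrix S S ℂ} (hH : H.IsHermitian) : (realMat H).IsSymm := by
  refine Matrix.IsSymm.ext fun i j => ?_
  have h := hH.apply j.1 i.1
  -- `conj (H i j) = H j i`
  have hre : (H i.1 j.1).re = (H j.1 i.1).re := by
    rw [← h]; simp
  have him : (H i.1 j.1).im = -(H j.1 i.1).im := by
    rw [← h]; simp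
  obtain ⟨x, a⟩ := i
  obtain ⟨y, b⟩ := j
  fin_cases a <;> fin_cases b <;>
    simp [realMat, Matrix.cons_val_zero, Matrix.cons_val_one, hre, him]

omit [Fintype S] in
/-- kernel: the real coordinates determine the field. [cite: BalabanImbrieJaffe1988, (5.12.2) p.301] -/
theorem realVec_injective : Function.Injective (realVec : (S → ℂ) → S × Fin 2 → ℝ) := by
  intro φ ψ h
  funext x
  apply Complex.ext
  · exact congrFun h (x, 0)
  · exact congrFun h (x, 1)

omit [Fintype S] in
/-- kernel: every real coordinate vector is the coordinate vector of a field. [cite: BalabanImbrieJaffe1988, (5.12.2) p.301] -/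
theorem realVec_surjective : Function.Surjective (realVec : (S → ℂ) → S × Fin 2 → ℝ) := by
  intro r
  refine ⟨fun x => ⟨r (x, 0), r (x, 1)⟩, ?_⟩
  funext i
  obtain ⟨x, a⟩ := i
  fin_cases a <;> rfl

/-- **A Hermitian kernel with positive form has a positive definite real matrix** (the hypothesis `hMpd`-type data of the scalar-sector files:
*"The inverse covariance is … bounded from above and below"*, p. 300). [cite: BalabanImbrieJaffe1988, (5.12.2) p.301] -/
theorem realMat_posDef {H : Matrix S S ℂ} (hH : H.IsHermitian) (hpos : ∀ φ : S → ℂ, φ ≠ 0 → 0 < (∑ x, ∑ y, conj (φ x) * H x y * φ y).re) :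
    (realMat H).PosDef := by
  rw [Matrix.posDef_iff_dotProduct_mulVec]
  refine ⟨?_, fun r hr => ?_⟩
  · -- Hermitian over `ℝ` = symmetric
    have hs := realMat_isSymm hH
    rw [Matrix.IsHermitian, Matrix.conjTranspose_eq_transpose_of_trivial]
    exact hs
  · obtain ⟨φ, rfl⟩ := realVec_surjective r
    have hφ : φ ≠ 0 := by
      rintro rfl
      exact hr (by funext i; obtain ⟨x, a⟩ := i; fin_cases a <;> rfl)
    rw [star_trivial, quadForm_realMat]
    exact hpos φ hφ

/-- **Positive definiteness passes to the `Λ₁₀`-block** (`B2Eq228Conditioning.blkIn` is a principal submatrix). [cite: BalabanImbrieJaffe1988, (5.12.2) p.301] -/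
theorem blkIn_realMat_posDef {H : Matrix S S ℂ} (p : S × Fin 2 → Prop) [DecidablePred p] (hH : H.IsHermitian)
    (hpos : ∀ φ : S → ℂ, φ ≠ 0 → 0 < (∑ x, ∑ y, conj (φ x) * H x y * φ y).re) :
    (B2Eq228Conditioning.blkIn p (realMat H)).PosDef := by
  unfold B2Eq228Conditioning.blkIn
  exact (realMat_posDef hH hpos).submatrix Subtype.val_injective

omit [Fintype S] in
/-- kernel: the real matrix depends measurably on parameters when the kernel does. [cite: BalabanImbrieJaffe1988, (5.12.2) p.301] -/
theorem measurable_realMat {α : Type*} [MeasurableSpace α] {H : α → Matrix S S ℂ} (hH : ∀ x y, Measurable fun v => H v x y)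
    (i j : S × Fin 2) : Measurable fun v => realMat (H v) i j := by
  obtain ⟨x, a⟩ := i
  obtain ⟨y, b⟩ := j
  fin_cases a <;> fin_cases b <;>
    simp only [realMat, Matrix.cons_val_zero, Matrix.cons_val_one, Matrix.of_apply, Matrix.cons_val', Matrix.empty_val',
      Matrix.cons_val_fin_one, Fin.zero_eta, Fin.mk_one, Fin.isValue]
  · exact Complex.measurable_re.comp (hH x y)
  · exact (Complex.measurable_im.comp (hH x y)).neg
  · exact Complex.measurable_im.comp (hH x y)
  · exact Complex.measurable_re.comp (hH x y)

/-! ## §2 The `φ^{(k)}`-Gaussian of Sect. 5.12 in the form used by the scalar-sector files -/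

/-- **THE `φ^{(k)}`-GAUSSIAN IN REAL COORDINATES**: `exp[−½ Re⟨φ^{(k)}, Hφ^{(k)}⟩] = exp[−½⟨φ_ℝ, M_Hφ_ℝ⟩]` with `φ_ℝ = realCoords φ^{(k)}` and
`M_H = realMat H` — the shape of the structural hypothesis `hJ` of `BIJ88Eq5128ScalarSector.eq5128_scalar` /
`BIJ88Eq5128ScalarFunction.ae_eq_cond_scalar` for the printed Gaussian `exp[−½⟨φ, (Δ_k(u_{k+1}) + aL^{−2}P(u_{k+1}))φ⟩]`, `H` its complex kernel
(Hermitian ⇒ `M_H` symmetric, positive ⇒ `Λ₁₀`-block positive definite, measurable in the block field when `H` is: §1).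
[cite: BalabanImbrieJaffe1988, (5.12.2) p.301] -/
theorem higgsGaussian_realCoords {P : Params} {k : ℕ} (H : Matrix (Balaban1983to89.Site P k) (Balaban1983to89.Site P k) ℂ) (φ : HiggsField P k) :
    Real.exp (-(1 / 2 : ℝ) * (∑ x, ∑ y, conj (φ x) * H x y * φ y).re) =
      Real.exp (-(1 / 2 : ℝ) * (realCoords φ ⬝ᵥ (realMat H *ᵥ realCoords φ))) := by
  rw [realCoords_eq_realVec, quadForm_realMat]

end

end Literature.MathematicalPhysics.QuantumFieldTheory.BalabanImbrieJaffe1984to88.BIJ88HiggsRealForm
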